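import Summits.Ventures.PercRepro.S1CFGDepFour
import Summits.Ventures.PercRepro.S1CFGDepFourSharpArith

/-!
# PercRepro — THE EXACT BASE OF THE SHARP DEPENDENT-`4`-SET CAP: NULLITY `2` (p1, gen 40)

`M` finite, simple (no dependent pair), coloop-free, of nullity `2` on `n` points: `D₄ ≤ n = B(2, n)`
(`ncard_four_eRk_le_three_le_sharp_two`). For `n ≥ 6`: `c₃ ≤ 2` (S1CFGTrianglesTwo); if `c₃ ≤ 1`,
`D₄ ≤ (n − 3)·c₃ + c₄ ≤ (n − 3) + ⌊n/(n − 4)⌋ ≤ n`; if `c₃ = 2`, two distinct rank-`2` triples `T₁ ≠ T₂` have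
`|T₁ ∪ T₂| − rk (T₁ ∪ T₂) ≥ 2` (submodularity with `rk (T₁ ∩ T₂) = |T₁ ∩ T₂| ≤ 2`), so `T₁ ∪ T₂ = E`
(`union_eq_ground_of_two_triangles`: a proper subset has nullity `≤ 1`), `n ≤ 6`, and at `n = 6` the triangles are
disjoint and a dependent `4`-set contains one of them (a `2 + 2` split spans `E`: `T_i ⊆ cl (X ∩ T_i)`), so
`D₄ ≤ 3 + 3` (`ncard_four_eRk_le_three_le_six_of_disjoint`). Nothing about any cell is claimed. Axioms: standard.
-/

open scoped Matroid

namespace PercRepro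

namespace S1CFG

open Set S1CF

variable {α : Type}

/-- A set of at most two points of a matroid with no dependent pair (and `≥ 2` points) has rank equal to its size. -/
theorem eRk_toNat_eq_ncard_of_ncard_le_two (M : Matroid α) [M.Finite]
    (h0 : {P : Set α | P ⊆ M.E ∧ P.ncard = 2 ∧ M.Dep P}.ncard = 0) (hn : 2 ≤ M.E.ncard) {I : Set α}
    (hI : I ⊆ M.E) (hI2 : I.ncard ≤ 2) : (M.eRk I).toNat = I.ncard := by
  have hEfin := M.ground_finite
  obtain ⟨P, hIP, hPE, hP2⟩ := Set.exists_subsuperset_card_eq hI hI2 hn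
  have hPind := indep_of_ncard_eq_two_of_no_dep_pair M h0 hPE hP2
  have hIind : M.Indep I := hPind.subset hIP
  rw [hIind.eRk_eq_encard, ← (hEfin.subset hI).cast_ncard_eq, ENat.toNat_coe]

/-- **TWO TRIANGLES EXHAUST NULLITY `2`**: two distinct rank-`2` triples of a simple coloop-free matroid of nullity `2`
cover the ground set. -/
theorem union_eq_ground_of_two_triangles (M : Matroid α) [M.Finite]
    (hd : M.E.encard = M.eRank + ((2 : ℕ) : ℕ∞)) (hK : ∀ e, ¬ M.IsColoop e)
    (h0 : {P : Set α | P ⊆ M.E ∧ P.ncard = 2 ∧ M.Dep P}.ncard = 0) {T₁ T₂ : Set α}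
    (hT₁ : T₁ ⊆ M.E ∧ T₁.ncard = 3 ∧ M.eRk T₁ ≤ 2) (hT₂ : T₂ ⊆ M.E ∧ T₂.ncard = 3 ∧ M.eRk T₂ ≤ 2)
    (hne : T₁ ≠ T₂) : T₁ ∪ T₂ = M.E := by
  have hEfin := M.ground_finite
  obtain ⟨hT₁E, hT₁3, hT₁r⟩ := hT₁
  obtain ⟨hT₂E, hT₂3, hT₂r⟩ := hT₂
  have hT₁fin : T₁.Finite := hEfin.subset hT₁E
  have hT₂fin : T₂.Finite := hEfin.subset hT₂E
  have hn : 2 ≤ M.E.ncard := by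
    have := Set.ncard_le_ncard hT₁E hEfin
    omega
  have hUE : T₁ ∪ T₂ ⊆ M.E := union_subset hT₁E hT₂E
  -- the intersection has at most two points
  have hI2 : (T₁ ∩ T₂).ncard ≤ 2 := by
    by_contra h
    push Not at h
    have h3 : (T₁ ∩ T₂).ncard = 3 := by
      have := Set.ncard_le_ncard (inter_subset_left : T₁ ∩ T₂ ⊆ T₁) hT₁fin
      omega
    have e1 : T₁ ∩ T₂ = T₁ := Set.eq_of_subset_of_ncard_le inter_subset_left (by omega) hT₁fin
    have e2 : T₁ ∩ T₂ = T₂ := Set.eq_of_subset_of_ncard_le inter_subset_right (by omega) hT₂fin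
    exact hne (e1.symm.trans e2)
  have hrI : (M.eRk (T₁ ∩ T₂)).toNat = (T₁ ∩ T₂).ncard :=
    eRk_toNat_eq_ncard_of_ncard_le_two M h0 hn (inter_subset_left.trans hT₁E) hI2
  -- submodularity: `rk I + rk U ≤ rk T₁ + rk T₂ ≤ 4`
  have hsub : (M.eRk (T₁ ∩ T₂)).toNat + (M.eRk (T₁ ∪ T₂)).toNat ≤ 4 := by
    have h := M.eRk_inter_add_eRk_union_le T₁ T₂
    have h' : M.eRk T₁ + M.eRk T₂ ≤ 4 := by
      calc M.eRk T₁ + M.eRk T₂ ≤ 2 + 2 := add_le_add hT₁r hT₂r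
        _ = 4 := by rfl
    have h'' := h.trans h'
    rw [← S1.coe_toNat_eRk M (inter_subset_left.trans hT₁E), ← S1.coe_toNat_eRk M hUE] at h''
    exact_mod_cast h''
  have hcard := Set.ncard_union_add_ncard_inter T₁ T₂ hT₁fin hT₂fin
  -- a proper subset has nullity `≤ 1`
  by_contra hUne
  have := ncard_add_one_le_eRk_toNat_add_of_ssubset M hd hK hUE hUne
  omega

/-- **`D₄ ≤ 6` ON TWO DISJOINT TRIANGLES**: if `E = T₁ ⊔ T₂` with `T₁`, `T₂` rank-`2` triples and `rk E = 4`, every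
dependent `4`-set contains one of the triangles, so there are at most `3 + 3` of them. -/
theorem ncard_four_eRk_le_three_le_six_of_disjoint (M : Matroid α) [M.Finite]
    (h0 : {P : Set α | P ⊆ M.E ∧ P.ncard = 2 ∧ M.Dep P}.ncard = 0) {T₁ T₂ : Set α}
    (hT₁ : T₁ ⊆ M.E ∧ T₁.ncard = 3 ∧ M.eRk T₁ ≤ 2) (hT₂ : T₂ ⊆ M.E ∧ T₂.ncard = 3 ∧ M.eRk T₂ ≤ 2)
    (hdisj : Disjoint T₁ T₂) (hU : T₁ ∪ T₂ = M.E) (hr : (M.eRk M.E).toNat = 4) :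
    {X : Set α | X ⊆ M.E ∧ X.ncard = 4 ∧ M.eRk X ≤ 3}.ncard ≤ 6 := by
  have hEfin := M.ground_finite
  obtain ⟨hT₁E, hT₁3, hT₁r⟩ := hT₁
  obtain ⟨hT₂E, hT₂3, hT₂r⟩ := hT₂
  have hT₁fin : T₁.Finite := hEfin.subset hT₁E
  have hT₂fin : T₂.Finite := hEfin.subset hT₂E
  -- a pair of a rank-`2` triple spans the triple
  have hspan : ∀ T : Set α, T ⊆ M.E → T.ncard = 3 → M.eRk T ≤ 2 → ∀ P ⊆ T, P.ncard = 2 →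
      T ⊆ M.closure P := by
    intro T hTE hT3 hTr P hPT hP2
    have hPE : P ⊆ M.E := hPT.trans hTE
    have hPind := indep_of_ncard_eq_two_of_no_dep_pair M h0 hPE hP2
    intro t ht
    apply mem_closure_pair_of_eRk_insert_le_two M hPE hPind hP2 (hTE ht)
    exact (M.eRk_mono (insert_subset ht hPT)).trans hTr
  have hsub : {X : Set α | X ⊆ M.E ∧ X.ncard = 4 ∧ M.eRk X ≤ 3} ⊆
      (fun x => insert x T₁) '' T₂ ∪ (fun x => insert x T₂) '' T₁ := by
    rintro X ⟨hXE, hX4, hXr⟩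
    have hXfin : X.Finite := hEfin.subset hXE
    have hX1 : (X ∩ T₁).ncard ≤ 3 := by
      have := Set.ncard_le_ncard (inter_subset_right : X ∩ T₁ ⊆ T₁) hT₁fin
      omega
    have hX2 : (X ∩ T₂).ncard ≤ 3 := by
      have := Set.ncard_le_ncard (inter_subset_right : X ∩ T₂ ⊆ T₂) hT₂fin
      omega
    -- `|X ∩ T₁| + |X ∩ T₂| = 4`
    have hsplit : (X ∩ T₁).ncard + (X ∩ T₂).ncard = 4 := by
      have h1 := Set.ncard_inter_add_ncard_sdiff_eq_ncard X T₁ hXfin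
      have h2 : X \ T₁ = X ∩ T₂ := by
        ext x
        simp only [mem_sdiff, mem_inter_iff]
        constructor
        · rintro ⟨hx, hx1⟩
          refine ⟨hx, ?_⟩
          have := hXE hx
          rw [← hU] at this
          rcases this with h | h
          · exact absurd h hx1
          · exact h
        · rintro ⟨hx, hx2⟩
          exact ⟨hx, fun hx1 => Set.disjoint_left.mp hdisj hx1 hx2⟩
      rw [h2] at h1
      omega
    -- the `2 + 2` split is impossible: it spans `E`
    have hnot22 : ¬ ((X ∩ T₁).ncard = 2 ∧ (X ∩ T₂).ncard = 2) := by
      rintro ⟨h1, h2⟩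
      have hcl1 : T₁ ⊆ M.closure X :=
        (hspan T₁ hT₁E hT₁3 hT₁r (X ∩ T₁) inter_subset_right h1).trans
          (M.closure_subset_closure inter_subset_left)
      have hcl2 : T₂ ⊆ M.closure X :=
        (hspan T₂ hT₂E hT₂3 hT₂r (X ∩ T₂) inter_subset_right h2).trans
          (M.closure_subset_closure inter_subset_left)
      have hEcl : M.E ⊆ M.closure X := by
        rw [← hU]
        exact union_subset hcl1 hcl2
      have h4 : M.eRk M.E ≤ M.eRk X := by
        calc M.eRk M.E ≤ M.eRk (M.closure X) := M.eRk_mono hEcl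
          _ = M.eRk X := M.eRk_closure_eq X
      rw [← S1.coe_toNat_eRk M (subset_refl M.E), hr] at h4
      have h5 : (4 : ℕ∞) ≤ 3 := h4.trans hXr
      exact absurd h5 (by decide)
    rcases Nat.lt_or_ge (X ∩ T₁).ncard 3 with hlt | hge
    · -- then `|X ∩ T₂| = 3`: `X = insert x T₂`
      have h2 : (X ∩ T₂).ncard = 3 := by
        rcases Nat.lt_or_ge (X ∩ T₂).ncard 3 with hlt2 | hge2
        · exfalso
          apply hnot22
          omega
        · omega
      have hT₂X : T₂ ⊆ X := by
        have := Set.eq_of_subset_of_ncard_le (inter_subset_right : X ∩ T₂ ⊆ T₂) (by omega) hT₂fin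
        rw [← this]
        exact inter_subset_left
      have hdiff : (X \ T₂).ncard = 1 := by
        have := Set.ncard_sdiff_add_ncard_of_subset hT₂X hXfin
        omega
      obtain ⟨x, hx⟩ := Set.ncard_eq_one.mp hdiff
      have hxX : x ∈ X \ T₂ := by rw [hx]; exact mem_singleton x
      right
      refine ⟨x, ?_, ?_⟩
      · have := hXE hxX.1
        rw [← hU] at this
        rcases this with h | h
        · exact h
        · exact absurd h hxX.2
      · simp only
        rw [← Set.singleton_union, ← hx, Set.sdiff_union_of_subset hT₂X]
    · -- `|X ∩ T₁| = 3`: `X = insert x T₁`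
      have h1 : (X ∩ T₁).ncard = 3 := by omega
      have hT₁X : T₁ ⊆ X := by
        have := Set.eq_of_subset_of_ncard_le (inter_subset_right : X ∩ T₁ ⊆ T₁) (by omega) hT₁fin
        rw [← this]
        exact inter_subset_left
      have hdiff : (X \ T₁).ncard = 1 := by
        have := Set.ncard_sdiff_add_ncard_of_subset hT₁X hXfin
        omega
      obtain ⟨x, hx⟩ := Set.ncard_eq_one.mp hdiff
      have hxX : x ∈ X \ T₁ := by rw [hx]; exact mem_singleton x
      left
      refine ⟨x, ?_, ?_⟩
      · have := hXE hxX.1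
        rw [← hU] at this
        rcases this with h | h
        · exact absurd h hxX.2
        · exact h
      · simp only
        rw [← Set.singleton_union, ← hx, Set.sdiff_union_of_subset hT₁X]
  calc {X : Set α | X ⊆ M.E ∧ X.ncard = 4 ∧ M.eRk X ≤ 3}.ncard
      ≤ ((fun x => insert x T₁) '' T₂ ∪ (fun x => insert x T₂) '' T₁).ncard :=
        Set.ncard_le_ncard hsub ((hT₂fin.image _).union (hT₁fin.image _))
    _ ≤ ((fun x => insert x T₁) '' T₂).ncard + ((fun x => insert x T₂) '' T₁).ncard := Set.ncard_union_le _ _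
    _ ≤ T₂.ncard + T₁.ncard := Nat.add_le_add (Set.ncard_image_le hT₂fin) (Set.ncard_image_le hT₁fin)
    _ = 6 := by rw [hT₁3, hT₂3]

/-- **THE EXACT BASE `ν = 2`**: `D₄ ≤ B(2, n) = n`. -/
theorem ncard_four_eRk_le_three_le_sharp_two (M : Matroid α) [M.Finite]
    (hd : M.E.encard = M.eRank + ((2 : ℕ) : ℕ∞)) (hK : ∀ e, ¬ M.IsColoop e)
    (h0 : {P : Set α | P ⊆ M.E ∧ P.ncard = 2 ∧ M.Dep P}.ncard = 0) :
    {X : Set α | X ⊆ M.E ∧ X.ncard = 4 ∧ M.eRk X ≤ 3}.ncard ≤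
      (2 + 1).choose 4 + (M.E.ncard - 2 - 1) * (2 + 1).choose 3 + (2 + 1).choose 2 := by
  have hEfin := M.ground_finite
  have hnE := ncard_ground_eq_eRk_toNat_add M hd
  rcases Nat.lt_or_ge M.E.ncard 6 with hlt | hge
  · exact (ncard_four_eRk_le_three_le_choose M (subset_refl M.E)).trans (sharp_small (by omega))
  have hc3 := ncard_three_eRk_le_two_le_choose_succ_add_one' M hd hK h0 (by omega)
  simp only [show (2 + 1).choose 3 + 1 = 2 by decide] at hc3
  rcases Nat.lt_or_ge {X : Set α | X ⊆ M.E ∧ X.ncard = 3 ∧ M.eRk X ≤ 2}.ncard 2 with hlt2 | hge2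
  · -- `c₃ ≤ 1`
    have hD := ncard_four_eRk_le_three_le_add M h0
    have hc4 := ncard_fourCircuits_le_div M hK hd (by omega)
    exact sharp_base_large hge hD (by omega) hc4
  · -- `c₃ = 2`: two triangles cover `E`, `n ≤ 6`
    have hc3eq : {X : Set α | X ⊆ M.E ∧ X.ncard = 3 ∧ M.eRk X ≤ 2}.ncard = 2 := by omega
    obtain ⟨T₁, T₂, hne, hTT⟩ := Set.ncard_eq_two.mp hc3eq
    have hT₁ : T₁ ∈ {X : Set α | X ⊆ M.E ∧ X.ncard = 3 ∧ M.eRk X ≤ 2} := by rw [hTT]; exact mem_insert T₁ {T₂}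
    have hT₂ : T₂ ∈ {X : Set α | X ⊆ M.E ∧ X.ncard = 3 ∧ M.eRk X ≤ 2} := by
      rw [hTT]; exact mem_insert_of_mem T₁ (mem_singleton T₂)
    have hU := union_eq_ground_of_two_triangles M hd hK h0 hT₁ hT₂ hne
    have hT₁fin : T₁.Finite := hEfin.subset hT₁.1
    have hT₂fin : T₂.Finite := hEfin.subset hT₂.1
    have hcard := Set.ncard_union_add_ncard_inter T₁ T₂ hT₁fin hT₂fin
    rw [hU, hT₁.2.1, hT₂.2.1] at hcard
    have hn6 : M.E.ncard = 6 := by omega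
    have hI0 : (T₁ ∩ T₂).ncard = 0 := by omega
    have hdisj : Disjoint T₁ T₂ := by
      rw [Set.disjoint_iff_inter_eq_empty]
      exact (Set.ncard_eq_zero (hT₁fin.inter_of_left T₂)).mp hI0
    have hr : (M.eRk M.E).toNat = 4 := by omega
    have := ncard_four_eRk_le_three_le_six_of_disjoint M h0 hT₁ hT₂ hdisj hU hr
    rw [sharp_base_eq M.E.ncard (by omega), hn6]
    exact this

end S1CFG

end PercRepro
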